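import Mathlib
import Literature.Combinatorics.Additive.TripleProductProperty

/-!
# Concatenation of STPP families in a cyclic `p`-tower — stub `stub_concatSTPP` of line `Sketch`
(crux `AutomaticPackingThesis`, stmt-MatrixMultiplication-7356)

STPP families in `ℤ/p^K` and `ℤ/p^K'` CONCATENATE digit-wise — low digits from the first family,
high digits from the second, product-indexed — into an STPP family in `ℤ/p^(K+K')`, with block
sizes multiplying (crux idea `concatenation-monoid-normal-form`, first lemma `ConcatSTPP`).
Proof: reduce the six-term STPP relation mod `p^K`; the low family's STPP forces equal low
indices AND equal low elements, so the low part of the relation vanishes as an integer, and the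
relation divided by `p^K` is the high family's relation mod `p^K'`. No guard digits, no
carry-free windows.
-/

set_option linter.dupNamespace false

namespace Summit.MatrixMultiplication.MatrixMultiplication.Theorems.AutomaticPackingThesis

open Finset Literature.Combinatorics.Additive

/-- The concatenation map `(x, y) ↦ x.val + p^K · y.val` from `ℤ/p^K × ℤ/p^K'` to `ℤ/p^(K+K')`
is injective (`p ≠ 0`). [folklore] -/
theorem concatMap_injective (p K K' : ℕ) (hp : 0 < p) :
    Function.Injective fun x : ZMod (p ^ K) × ZMod (p ^ K') =>
      ((x.1.val + p ^ K * x.2.val : ℕ) : ZMod (p ^ (K + K'))) := by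
  haveI : NeZero (p ^ K) := ⟨pow_ne_zero _ hp.ne'⟩
  haveI : NeZero (p ^ K') := ⟨pow_ne_zero _ hp.ne'⟩
  rintro ⟨x₁, x₂⟩ ⟨y₁, y₂⟩ h
  have hx : x₁.val + p ^ K * x₂.val < p ^ (K + K') := by
    have h1 := x₁.val_lt
    have h2 := x₂.val_lt
    calc x₁.val + p ^ K * x₂.val < p ^ K + p ^ K * x₂.val := by omega
      _ = p ^ K * (x₂.val + 1) := by ring
      _ ≤ p ^ K * p ^ K' := Nat.mul_le_mul_left _ h2
      _ = p ^ (K + K') := (pow_add _ _ _).symm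
  have hy : y₁.val + p ^ K * y₂.val < p ^ (K + K') := by
    have h1 := y₁.val_lt
    have h2 := y₂.val_lt
    calc y₁.val + p ^ K * y₂.val < p ^ K + p ^ K * y₂.val := by omega
      _ = p ^ K * (y₂.val + 1) := by ring
      _ ≤ p ^ K * p ^ K' := Nat.mul_le_mul_left _ h2
      _ = p ^ (K + K') := (pow_add _ _ _).symm
  have h' := congrArg ZMod.val h
  simp only [ZMod.val_natCast_of_lt hx, ZMod.val_natCast_of_lt hy] at h'
  -- uniqueness of division with remainder by `p^K`
  have hpK : 0 < p ^ K := pos_iff_ne_zero.2 (NeZero.ne _)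
  have h1 : x₁.val = y₁.val := by
    have := congrArg (· % p ^ K) h'
    simpa [Nat.add_mul_mod_self_left, Nat.mod_eq_of_lt x₁.val_lt, Nat.mod_eq_of_lt y₁.val_lt]
      using this
  have h2 : x₂.val = y₂.val := by
    have := congrArg (· / p ^ K) h'
    simpa [Nat.add_mul_div_left _ _ hpK, Nat.div_eq_of_lt x₁.val_lt, Nat.div_eq_of_lt y₁.val_lt]
      using this
  exact Prod.ext (ZMod.val_injective _ h1) (ZMod.val_injective _ h2)

/-- **Concatenation of STPP families** (digit-wise, in a cyclic `p`-tower; registered stub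
`stub_concatSTPP` of line `Sketch`): if `(A, B, C)` is an STPP family in `ℤ/p^K` and
`(A', B', C')` one in `ℤ/p^K'`, then the product-indexed family of concatenated blocks
`{x.val + p^K y.val : x ∈ A i, y ∈ A' i'}` (read in `ℤ/p^(K+K')`) is an STPP family: reduce the
STPP relation mod `p^K`, where the low family forces equal low indices and elements; the low part
then vanishes as an integer and the relation divided by `p^K` is the high family's relation.
Consequence: finite STPP designs in the `p`-tower form a graded monoid under concatenation and
their packing ratio `Σ_i x_i^τ / p^K` is multiplicative (crux idea
`concatenation-monoid-normal-form`). [folklore] -/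
theorem stub_concatSTPP (p K K' : ℕ) (hp : 0 < p) (ι ι' : Type)
    (A B C : ι → Finset (ZMod (p ^ K))) (A' B' C' : ι' → Finset (ZMod (p ^ K')))
    (h : AddSimultaneousTPP A B C) (h' : AddSimultaneousTPP A' B' C') :
    AddSimultaneousTPP
      (fun i : ι × ι' => (A i.1 ×ˢ A' i.2).image
        fun x => ((x.1.val + p ^ K * x.2.val : ℕ) : ZMod (p ^ (K + K'))))
      (fun i : ι × ι' => (B i.1 ×ˢ B' i.2).image
        fun x => ((x.1.val + p ^ K * x.2.val : ℕ) : ZMod (p ^ (K + K'))))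
      (fun i : ι × ι' => (C i.1 ×ˢ C' i.2).image
        fun x => ((x.1.val + p ^ K * x.2.val : ℕ) : ZMod (p ^ (K + K')))) := by
  haveI : NeZero (p ^ K) := ⟨pow_ne_zero _ hp.ne'⟩
  haveI : NeZero (p ^ K') := ⟨pow_ne_zero _ hp.ne'⟩
  rw [addSimultaneousTPP_iff_forall] at h h' ⊢
  rintro ⟨i, i'⟩ ⟨j, j'⟩ ⟨k, k'⟩ s hs s₀ hs₀ t ht t₀ ht₀ u hu u₀ hu₀ hrel
  simp only [mem_image, mem_product] at hs hs₀ ht ht₀ hu hu₀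
  obtain ⟨⟨s₁, s₂⟩, ⟨hs₁, hs₂⟩, rfl⟩ := hs
  obtain ⟨⟨s₁', s₂'⟩, ⟨hs₁', hs₂'⟩, rfl⟩ := hs₀
  obtain ⟨⟨t₁, t₂⟩, ⟨ht₁, ht₂⟩, rfl⟩ := ht
  obtain ⟨⟨t₁', t₂'⟩, ⟨ht₁', ht₂'⟩, rfl⟩ := ht₀
  obtain ⟨⟨u₁, u₂⟩, ⟨hu₁, hu₂⟩, rfl⟩ := hu
  obtain ⟨⟨u₁', u₂'⟩, ⟨hu₁', hu₂'⟩, rfl⟩ := hu₀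
  -- the relation as a divisibility in `ℤ`
  set L : ℤ := ((s₁'.val : ℤ) - s₁.val) + ((t₁'.val : ℤ) - t₁.val) + ((u₁'.val : ℤ) - u₁.val) with hL
  set H : ℤ := ((s₂'.val : ℤ) - s₂.val) + ((t₂'.val : ℤ) - t₂.val) + ((u₂'.val : ℤ) - u₂.val) with hH
  dsimp only at hrel
  have hdvd0 : ((p ^ (K + K') : ℕ) : ℤ) ∣ L + (p : ℤ) ^ K * H := by
    rw [← ZMod.intCast_zmod_eq_zero_iff_dvd]
    rw [hL, hH]
    push_cast
    have : (((s₁'.val + p ^ K * s₂'.val : ℕ) : ZMod (p ^ (K + K'))) -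
        ((s₁.val + p ^ K * s₂.val : ℕ) : ZMod (p ^ (K + K')))) +
        ((((t₁'.val + p ^ K * t₂'.val : ℕ) : ZMod (p ^ (K + K'))) -
          ((t₁.val + p ^ K * t₂.val : ℕ) : ZMod (p ^ (K + K'))))) +
        ((((u₁'.val + p ^ K * u₂'.val : ℕ) : ZMod (p ^ (K + K'))) -
          ((u₁.val + p ^ K * u₂.val : ℕ) : ZMod (p ^ (K + K'))))) = 0 := hrel
    push_cast at this
    linear_combination this
  have hdvd : ((p : ℤ) ^ (K + K')) ∣ L + (p : ℤ) ^ K * H := by exact_mod_cast hdvd0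
  -- low part: `p^K ∣ L`
  have hlow : ((p : ℤ) ^ K) ∣ L := by
    have h1 : ((p : ℤ) ^ K) ∣ (p : ℤ) ^ (K + K') := pow_dvd_pow _ (Nat.le_add_right _ _)
    exact (dvd_add_left (dvd_mul_right _ _)).1 (h1.trans hdvd)
  have hlow' : (s₁' - s₁) + (t₁' - t₁) + (u₁' - u₁) = (0 : ZMod (p ^ K)) := by
    have := (ZMod.intCast_zmod_eq_zero_iff_dvd L (p ^ K)).2 (by exact_mod_cast hlow)
    rw [hL] at this
    push_cast at this
    simpa only [ZMod.natCast_val, ZMod.cast_id', id] using this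
  obtain ⟨hij, hjk, hss, htt, huu⟩ := h i j k s₁ hs₁ s₁' hs₁' t₁ ht₁ t₁' ht₁' u₁ hu₁ u₁' hu₁' hlow'
  subst hij hjk hss htt huu
  -- so `L = 0` and the high part carries the relation
  have hL0 : L = 0 := by rw [hL]; ring
  have hhigh : ((p : ℤ) ^ K') ∣ H := by
    rw [hL0, zero_add, pow_add] at hdvd
    exact (mul_dvd_mul_iff_left (pow_ne_zero _ (by exact_mod_cast hp.ne'))).1 hdvd
  have hhigh' : (s₂' - s₂) + (t₂' - t₂) + (u₂' - u₂) = (0 : ZMod (p ^ K')) := by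
    have := (ZMod.intCast_zmod_eq_zero_iff_dvd H (p ^ K')).2 (by exact_mod_cast hhigh)
    rw [hH] at this
    push_cast at this
    simpa only [ZMod.natCast_val, ZMod.cast_id', id] using this
  obtain ⟨hij', hjk', hss', htt', huu'⟩ :=
    h' i' j' k' s₂ hs₂ s₂' hs₂' t₂ ht₂ t₂' ht₂' u₂ hu₂ u₂' hu₂' hhigh'
  subst hij' hjk' hss' htt' huu'
  exact ⟨rfl, rfl, rfl, rfl, rfl⟩

/-- Block sizes multiply under concatenation. [folklore] -/
theorem card_concat (p K K' : ℕ) (hp : 0 < p) (S : Finset (ZMod (p ^ K)))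
    (S' : Finset (ZMod (p ^ K'))) :
    ((S ×ˢ S').image fun x => ((x.1.val + p ^ K * x.2.val : ℕ) : ZMod (p ^ (K + K')))).card =
      S.card * S'.card := by
  rw [card_image_of_injective _ (concatMap_injective p K K' hp), card_product]

end Summit.MatrixMultiplication.MatrixMultiplication.Theorems.AutomaticPackingThesis
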